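import Literature.Analysis.FunctionSpaces.TorusTrigPoly
import Literature.Analysis.FunctionSpaces.TorusTranslationEstimate
import Literature.Analysis.FunctionSpaces.TorusMollifier
import Mathlib.Algebra.Order.Chebyshev
import HarnessLib

/-!
# Moments of trigonometric polynomials on `𝕋^d` through DISCRETE DIFFERENCES of their coefficients

Analysis/FunctionSpaces support file (everything proved; no definitions, no named facts).  The elementary device
behind kernel-moment bounds `∫ |x|^m |K(x)| dx ≲ L^{−m}` for a Fourier multiplier whose symbol varies on the scale
`L`: multiplying a trigonometric polynomial by the character increment `e_{e_j}(z) − 1 = e^{2πi z_j} − 1` SHIFTS AND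
DIFFERENCES its coefficients, so Parseval turns spatial weights into discrete derivatives of the symbol
(Grafakos 2014, Prop. 3.1.2 (9)/(10) and Prop. 3.2.7 (3) — translation/modulation and Plancherel on `𝕋ⁿ`; the
continuous analogue is `x^m K(x) ↔ ∂_ξ^m K̂`):

* `charIncr_mul_trigPoly` — `(e_{e_j}(z) − 1)·Σ_{k∈A} c_k e_k(z) = Σ_{k∈B} (c_{k−e_j} − c_k) e_k(z)` for `c` vanishing off
  `A` and `B ⊇ A ∪ (A + e_j)`; iterated: `charIncr_pow_mul_trigPoly` with the `p`-fold backward difference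
  `(D_j^p c)(k) = Σ …` realised as `Nat.iterate` of `c ↦ (k ↦ c (k − e_j) − c k)`;
* `integral_charIncr_pow_mul_norm_sq_trigPoly` — **`∫ |e_{e_j}(z) − 1|^{2p} ‖Σ_A c_k e_k(z)‖² dz = Σ_{k∈B} ‖(D_j^p c)(k)‖²`**;
* `abs_reprc_apply_le_norm_charIncr` — `|reprc z _j| ≤ ¼ ‖e_{e_j}(z) − 1‖` (Jordan's inequality `sin x ≥ 2x/π` on
  `[0, π/2]`, the centred coordinate lying in `[−½, ½]`);
* `integral_norm_reprc_pow_mul_norm_sq_trigPoly_le` — hence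
  **`∫ ‖reprc z‖^{2p} ‖Σ_A c_k e_k(z)‖² dz ≤ (d^{p−1}/16^p) Σ_j Σ_{k∈B} ‖(D_j^p c)(k)‖²`** (power mean over the `d`
  coordinates), `p ≥ 1`.

Consumer: cell `ad-ideate`, K1L_D `stmt-AnomalousDissipation-27980`, W3-E (i): the kernel moment
`∫ ‖reprc z‖³ |∇K_ω(z)| dz ≲ ε²` of the dissipation-scale weight `ω_k = Ψ(ε²|k|²)` (crux memo
`Lines/onelevel-W3E-k3l-lyapunov.md`, re-plan P2, Layer 1–2a).

## Mathlib / tree search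
Tree: `TorusTrigPoly` (`trigPoly`, `integral_norm_sq_trigPoly` = finite Parseval, `mFourier_apply_add`),
`TorusTranslationEstimate.mFourier_proj_eq_exp_sum`, `TorusMollifier` (`reprc`, `proj_reprc`, `abs_reprc_apply_le`).
Mathlib: `Complex.norm_exp_I_mul_ofReal_sub_one`, `Real.mul_le_sin` (Jordan), `pow_sum_div_card_le_sum_pow` (power mean).

## References
* L. Grafakos, *Classical Fourier Analysis*, 3rd ed. (2014), Prop. 3.1.2 (9)–(10), Prop. 3.2.7 (3). [`Grafakos2014`]
-/

noncomputable section

open MeasureTheory Set Filter Complex UnitAddTorus Function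
open scoped ENNReal InnerProductSpace ComplexConjugate

namespace Literature.Analysis.FunctionSpaces

namespace Torus

variable {d : Type*} [Fintype d] [DecidableEq d]
variable {V : Type*} [NormedAddCommGroup V] [InnerProductSpace ℂ V]

/-! ## §1 Character increments shift and difference the coefficients -/

/-- **One character increment**: for `c` vanishing off `A` and `B ⊇ A ∪ (A + e_j)`,
`(e_{e_j}(z) − 1) • Σ_{k∈A} e_k(z) c_k = Σ_{k∈B} e_k(z) (c_{k−e_j} − c_k)`. [cite: Grafakos2014, Prop. 3.1.2 (9)] -/
theorem charIncr_mul_trigPoly (A B : Finset (d → ℤ)) (c : (d → ℤ) → V) (j : d)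
    (hc : ∀ k, k ∉ A → c k = 0) (hAB : ∀ k ∈ A, k ∈ B ∧ k + Pi.single j 1 ∈ B) (z : UnitAddTorus d) :
    (mFourier (Pi.single j 1) z - 1) • trigPoly A c z =
      trigPoly B (fun k => c (k - Pi.single j 1) - c k) z := by
  -- the shifted polynomial
  have hshift : mFourier (Pi.single j 1) z • trigPoly A c z = trigPoly B (fun k => c (k - Pi.single j 1)) z := by
    rw [trigPoly_apply, trigPoly_apply, Finset.smul_sum]
    -- reindex `k ↦ k + e_j` from `A` into `B`
    have hinj : Set.InjOn (fun k : d → ℤ => k + Pi.single j 1) (A : Set (d → ℤ)) := fun a _ b _ h => by simpa using h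
    have himg : A.image (fun k => k + Pi.single j 1) ⊆ B := by
      intro k hk
      obtain ⟨k', hk', rfl⟩ := Finset.mem_image.1 hk
      exact (hAB k' hk').2
    rw [← Finset.sum_subset himg, Finset.sum_image hinj]
    · refine Finset.sum_congr rfl fun k _ => ?_
      rw [add_sub_cancel_right, smul_smul, mFourier_add, mul_comm]
    · intro k _ hk
      have : c (k - Pi.single j 1) = 0 := by
        refine hc _ fun hkA => hk ?_
        exact Finset.mem_image.2 ⟨k - Pi.single j 1, hkA, by simp⟩
      rw [this, smul_zero]
  have hsame : trigPoly A c z = trigPoly B c z := by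
    have hAB' : A ⊆ B := fun k hk => (hAB k hk).1
    rw [trigPoly_subset hAB' fun k _ hkA => hc k hkA]
  rw [sub_smul, one_smul, hshift, hsame, trigPoly_apply, trigPoly_apply, ← Finset.sum_sub_distrib]
  refine Finset.sum_congr rfl fun k _ => ?_
  rw [smul_sub]

/-- **Iterated character increments**: for `c` vanishing off `A` and `B ⊇ A + {0,…,p}·e_j`,
`(e_{e_j}(z) − 1)^p • Σ_{k∈A} e_k(z) c_k = Σ_{k∈B} e_k(z) (D_j^p c)(k)`, `D_j c (k) = c(k − e_j) − c(k)`.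
[cite: Grafakos2014, Prop. 3.1.2 (9)] -/
theorem charIncr_pow_mul_trigPoly (A B : Finset (d → ℤ)) (c : (d → ℤ) → V) (j : d) (p : ℕ)
    (hc : ∀ k, k ∉ A → c k = 0) (hAB : ∀ k ∈ A, ∀ i : ℕ, i ≤ p → k + (i : ℤ) • Pi.single j (1:ℤ) ∈ B)
    (z : UnitAddTorus d) :
    (mFourier (Pi.single j 1) z - 1) ^ p • trigPoly A c z =
      trigPoly B ((fun (c' : (d → ℤ) → V) (k : d → ℤ) => c' (k - Pi.single j 1) - c' k)^[p] c) z := by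
  induction p generalizing c A with
  | zero =>
    simp only [pow_zero, one_smul, Function.iterate_zero, id_eq]
    have hAB' : A ⊆ B := fun k hk => by simpa using hAB k hk 0 le_rfl
    rw [trigPoly_subset hAB' fun k _ hkA => hc k hkA]
  | succ p ih =>
    -- first difference once (into `A' = A ∪ (A + e_j)`), then `p` more times
    set A' : Finset (d → ℤ) := A ∪ A.image (fun k => k + Pi.single j 1) with hA'
    have hstep := charIncr_mul_trigPoly A A' c j hc (fun k hk =>
      ⟨Finset.mem_union_left _ hk, Finset.mem_union_right _ (Finset.mem_image.2 ⟨k, hk, rfl⟩)⟩) z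
    have hc' : ∀ k, k ∉ A' → (fun k' => c (k' - Pi.single j 1) - c k') k = 0 := by
      intro k hk
      rw [hA', Finset.mem_union, not_or] at hk
      have h1 : c k = 0 := hc k hk.1
      have h2 : c (k - Pi.single j 1) = 0 :=
        hc _ fun hkA => hk.2 (Finset.mem_image.2 ⟨k - Pi.single j 1, hkA, by simp⟩)
      simp only [h1, h2, sub_zero]
    have hA'B : ∀ k ∈ A', ∀ i : ℕ, i ≤ p → k + (i : ℤ) • Pi.single j (1:ℤ) ∈ B := by
      intro k hk i hi
      rcases Finset.mem_union.1 hk with h | h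
      · exact hAB k h i (hi.trans (Nat.le_succ p))
      · obtain ⟨k₀, hk₀, rfl⟩ := Finset.mem_image.1 h
        have := hAB k₀ hk₀ (i + 1) (Nat.succ_le_succ hi)
        have e : k₀ + Pi.single j 1 + (i : ℤ) • Pi.single j (1:ℤ) = k₀ + ((i + 1 : ℕ) : ℤ) • Pi.single j (1:ℤ) := by
          push_cast; rw [add_smul, one_smul]; abel
        rw [e]; exact this
    rw [pow_succ, mul_smul, hstep, ih A' _ hc' hA'B, Function.iterate_succ_apply]

/-! ## §2 Parseval with character-increment weights -/

omit [DecidableEq d] in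
/-- `|e_k(z)| = 1` (file-local). [folklore] -/
private theorem norm_mFourier_apply' (n : d → ℤ) (x : UnitAddTorus d) : ‖mFourier n x‖ = 1 := by
  simp [mFourier]

/-- **Parseval with the weight `|e_{e_j} − 1|^{2p}`**: for `c` vanishing off `A` and `B ⊇ A + {0,…,p}·e_j`,
`∫ ‖e_{e_j}(z) − 1‖^{2p} ‖Σ_{k∈A} e_k(z) c_k‖² dz = Σ_{k∈B} ‖(D_j^p c)(k)‖²`. [cite: Grafakos2014, Prop. 3.2.7 (3)] -/
theorem integral_charIncr_pow_mul_norm_sq_trigPoly (A B : Finset (d → ℤ)) (c : (d → ℤ) → V) (j : d) (p : ℕ)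
    (hc : ∀ k, k ∉ A → c k = 0) (hAB : ∀ k ∈ A, ∀ i : ℕ, i ≤ p → k + (i : ℤ) • Pi.single j (1:ℤ) ∈ B) :
    ∫ z, ‖mFourier (Pi.single j 1) z - 1‖ ^ (2 * p) * ‖trigPoly A c z‖ ^ 2 =
      ∑ k ∈ B, ‖((fun (c' : (d → ℤ) → V) (k : d → ℤ) => c' (k - Pi.single j 1) - c' k)^[p] c) k‖ ^ 2 := by
  rw [← integral_norm_sq_trigPoly B]
  refine integral_congr_ae (ae_of_all _ fun z => ?_)
  dsimp only
  rw [← charIncr_pow_mul_trigPoly A B c j p hc hAB z, norm_smul, mul_pow, norm_pow, ← pow_mul, mul_comm 2 p]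

/-! ## §3 Centred coordinates versus character increments (Jordan's inequality) -/

/-- **`|reprc z _j| ≤ ¼ ‖e_{e_j}(z) − 1‖`**: the centred coordinate `s = reprc z _j ∈ [−½, ½]` satisfies
`|e^{2πis} − 1| = 2|sin(πs)| ≥ 4|s|` (Jordan). [cite: Grafakos2014, Prop. 3.1.2 (9)] -/
theorem abs_reprc_apply_le_norm_charIncr (z : UnitAddTorus d) (j : d) :
    |reprc z j| ≤ 1 / 4 * ‖mFourier (Pi.single j 1) z - 1‖ := by
  set s : ℝ := reprc z j with hs
  -- `e_{e_j}(z) = exp(2πi s)`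
  have he : mFourier (Pi.single j 1) z = Complex.exp (I * ((2 * Real.pi * s : ℝ) : ℂ)) := by
    conv_lhs => rw [← proj_reprc z]
    rw [mFourier_proj_eq_exp_sum]
    congr 1
    have : (∑ i, (((Pi.single j (1:ℤ) : d → ℤ) i : ℤ) : ℝ) * reprc z i) = s := by
      rw [Finset.sum_eq_single j]
      · simp [hs]
      · intro i _ hij; simp [hij]
      · intro h; exact absurd (Finset.mem_univ j) h
    rw [this]
    push_cast
    ring
  rw [he, Complex.norm_exp_I_mul_ofReal_sub_one]
  have hsd : 2 * Real.pi * s / 2 = Real.pi * s := by ring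
  rw [hsd, Real.norm_eq_abs, abs_mul, abs_of_pos (by norm_num : (0:ℝ) < 2)]
  -- Jordan on `[0, π/2]` applied to `π |s|`
  have hs_le : |s| ≤ 1 / 2 := abs_reprc_apply_le z j
  have hx0 : 0 ≤ Real.pi * |s| := mul_nonneg Real.pi_pos.le (abs_nonneg _)
  have hx1 : Real.pi * |s| ≤ Real.pi / 2 := by nlinarith [Real.pi_pos, abs_nonneg s]
  have hj := Real.mul_le_sin hx0 hx1
  have hsin : |Real.sin (Real.pi * s)| = Real.sin (Real.pi * |s|) := by
    have hnn : 0 ≤ Real.sin (Real.pi * |s|) :=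
      Real.sin_nonneg_of_nonneg_of_le_pi hx0 (by linarith [Real.pi_pos])
    rcases le_or_gt 0 s with h | h
    · have hs' : |s| = s := abs_of_nonneg h
      rw [hs'] at hnn ⊢
      exact abs_of_nonneg hnn
    · have hs' : |s| = -s := abs_of_neg h
      rw [hs'] at hnn ⊢
      rw [show Real.pi * s = -(Real.pi * -s) by ring, Real.sin_neg, abs_neg, abs_of_nonneg hnn]
  rw [hsin]
  have : 2 / Real.pi * (Real.pi * |s|) = 2 * |s| := by field_simp
  rw [this] at hj
  linarith

omit [DecidableEq d] in
/-- `‖reprc z‖² = Σ_j (reprc z _j)²` (file-local). [folklore] -/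
private theorem norm_reprc_sq (z : UnitAddTorus d) : ‖reprc z‖ ^ 2 = ∑ j, (reprc z j) ^ 2 := by
  rw [EuclideanSpace.norm_sq_eq]
  refine Finset.sum_congr rfl fun j _ => ?_
  rw [Real.norm_eq_abs, sq_abs]

/-- **`‖reprc z‖^{2p} ≤ (d^{p−1}/16^p) Σ_j ‖e_{e_j}(z) − 1‖^{2p}`** for `p ≥ 1` (power mean over the coordinates and
`|reprc z _j| ≤ ¼‖e_{e_j}(z) − 1‖`). [cite: Grafakos2014, Prop. 3.1.2 (9)] -/
theorem norm_reprc_pow_le_sum_charIncr (z : UnitAddTorus d) (p : ℕ) (hp : 1 ≤ p) :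
    ‖reprc z‖ ^ (2 * p) ≤ (Fintype.card d : ℝ) ^ (p - 1) / 16 ^ p *
      ∑ j, ‖mFourier (Pi.single j 1) z - 1‖ ^ (2 * p) := by
  obtain ⟨n, rfl⟩ : ∃ n, p = n + 1 := ⟨p - 1, by omega⟩
  simp only [Nat.add_sub_cancel]
  rw [pow_mul, norm_reprc_sq z]
  -- power mean: `(Σ_j x_j)^{n+1} ≤ d^n Σ_j x_j^{n+1}`
  have hpm := pow_sum_div_card_le_sum_pow (s := (Finset.univ : Finset d)) (f := fun j => reprc z j ^ 2)
    (fun j _ => sq_nonneg _) n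
  rw [Finset.card_univ] at hpm
  have h1 : (∑ j, reprc z j ^ 2) ^ (n + 1) ≤ (Fintype.card d : ℝ) ^ n * ∑ j, (reprc z j ^ 2) ^ (n + 1) := by
    rcases Nat.eq_zero_or_pos (Fintype.card d) with hd | hd
    · have : (Finset.univ : Finset d) = ∅ := Finset.univ_eq_empty_iff.2 (Fintype.card_eq_zero_iff.1 hd)
      simp [this]
    · have hpos : 0 < (Fintype.card d : ℝ) ^ n := pow_pos (by exact_mod_cast hd) n
      rw [div_le_iff₀ hpos] at hpm
      linarith
  refine h1.trans ?_
  rw [div_mul_eq_mul_div, le_div_iff₀ (by positivity), Finset.mul_sum, Finset.mul_sum, Finset.sum_mul]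
  refine Finset.sum_le_sum fun j _ => ?_
  have hj := abs_reprc_apply_le_norm_charIncr z j
  have h2 : reprc z j ^ 2 ≤ (1 / 4 * ‖mFourier (Pi.single j 1) z - 1‖) ^ 2 := by
    rw [← sq_abs]; exact pow_le_pow_left₀ (abs_nonneg _) hj 2
  have h3 : (reprc z j ^ 2) ^ (n + 1) ≤ ((1 / 4 * ‖mFourier (Pi.single j 1) z - 1‖) ^ 2) ^ (n + 1) :=
    pow_le_pow_left₀ (sq_nonneg _) h2 _
  calc (Fintype.card d : ℝ) ^ n * (reprc z j ^ 2) ^ (n + 1) * 16 ^ (n + 1)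
      ≤ (Fintype.card d : ℝ) ^ n * ((1 / 4 * ‖mFourier (Pi.single j 1) z - 1‖) ^ 2) ^ (n + 1) * 16 ^ (n + 1) := by
        gcongr
    _ = (Fintype.card d : ℝ) ^ n * ‖mFourier (Pi.single j 1) z - 1‖ ^ (2 * (n + 1)) := by
        have h16 : ((1:ℝ) / 4 * ‖mFourier (Pi.single j 1) z - 1‖) ^ 2 = ‖mFourier (Pi.single j 1) z - 1‖ ^ 2 / 16 := by
          ring
        rw [h16, div_pow, pow_mul]
        field_simp

/-- **Spatial moments of a trigonometric polynomial through differences of its coefficients**: for `p ≥ 1`,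
`c` vanishing off `A`, and `B ⊇ A + {0,…,p}·e_j` for every `j`,
`∫ ‖reprc z‖^{2p} ‖Σ_{k∈A} e_k(z) c_k‖² dz ≤ (d^{p−1}/16^p) Σ_j Σ_{k∈B} ‖(D_j^p c)(k)‖²`.
[cite: Grafakos2014, Prop. 3.2.7 (3)] -/
theorem integral_norm_reprc_pow_mul_norm_sq_trigPoly_le (A B : Finset (d → ℤ)) (c : (d → ℤ) → V) (p : ℕ) (hp : 1 ≤ p)
    (hc : ∀ k, k ∉ A → c k = 0) (hAB : ∀ j : d, ∀ k ∈ A, ∀ i : ℕ, i ≤ p → k + (i : ℤ) • Pi.single j (1:ℤ) ∈ B) :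
    ∫ z, ‖reprc z‖ ^ (2 * p) * ‖trigPoly A c z‖ ^ 2 ≤
      (Fintype.card d : ℝ) ^ (p - 1) / 16 ^ p *
        ∑ j, ∑ k ∈ B, ‖((fun (c' : (d → ℤ) → V) (k : d → ℤ) => c' (k - Pi.single j 1) - c' k)^[p] c) k‖ ^ 2 := by
  have hcont : Continuous (trigPoly A c) := continuous_trigPoly A c
  have hint : ∀ j, Integrable (fun z : UnitAddTorus d => ‖mFourier (Pi.single j 1) z - 1‖ ^ (2 * p) * ‖trigPoly A c z‖ ^ 2) volume :=
    fun j => ((((mFourier (Pi.single j 1)).continuous.sub continuous_const).norm.pow _).mul (hcont.norm.pow _)).integrable_of_hasCompactSupport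
      (HasCompactSupport.of_compactSpace _)
  calc ∫ z, ‖reprc z‖ ^ (2 * p) * ‖trigPoly A c z‖ ^ 2
      ≤ ∫ z, ((Fintype.card d : ℝ) ^ (p - 1) / 16 ^ p * ∑ j, ‖mFourier (Pi.single j 1) z - 1‖ ^ (2 * p)) * ‖trigPoly A c z‖ ^ 2 := by
        refine integral_mono_of_nonneg (ae_of_all _ fun z => mul_nonneg (pow_nonneg (norm_nonneg _) _) (sq_nonneg _)) ?_
          (ae_of_all _ fun z => mul_le_mul_of_nonneg_right (norm_reprc_pow_le_sum_charIncr z p hp) (sq_nonneg _))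
        have : Integrable (fun z : UnitAddTorus d => ∑ j, ‖mFourier (Pi.single j 1) z - 1‖ ^ (2 * p) * ‖trigPoly A c z‖ ^ 2) volume :=
          integrable_finsetSum _ fun j _ => hint j
        have e : (fun z : UnitAddTorus d => ((Fintype.card d : ℝ) ^ (p - 1) / 16 ^ p * ∑ j, ‖mFourier (Pi.single j 1) z - 1‖ ^ (2 * p)) *
            ‖trigPoly A c z‖ ^ 2) = fun z => (Fintype.card d : ℝ) ^ (p - 1) / 16 ^ p *
            ∑ j, ‖mFourier (Pi.single j 1) z - 1‖ ^ (2 * p) * ‖trigPoly A c z‖ ^ 2 := by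
          funext z; rw [mul_assoc, Finset.sum_mul]
        rw [e]; exact this.const_mul _
    _ = (Fintype.card d : ℝ) ^ (p - 1) / 16 ^ p * ∑ j, ∫ z, ‖mFourier (Pi.single j 1) z - 1‖ ^ (2 * p) * ‖trigPoly A c z‖ ^ 2 := by
        rw [← integral_finsetSum _ fun j _ => hint j, ← integral_const_mul]
        refine integral_congr_ae (ae_of_all _ fun z => ?_)
        dsimp only
        rw [mul_assoc, Finset.sum_mul]
    _ = _ := by
        congr 1
        refine Finset.sum_congr rfl fun j _ => ?_
        exact integral_charIncr_pow_mul_norm_sq_trigPoly A B c j p hc (hAB j)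

end Torus

end Literature.Analysis.FunctionSpaces

end
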